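import Mathlib
import Summits.NavierStokesRegularity.NavierStokesRegularity.Theorems.TaoLadderRungTwoBreakOneShiftWindowAmpHull
import Summits.NavierStokesRegularity.NavierStokesRegularity.Theorems.TaoLadderRungTwoBreakOneShiftWindowSensGrid
import Summits.NavierStokesRegularity.NavierStokesRegularity.Theorems.TaoLadderRungTwoBreakOneShiftWindowSensStepM
import HarnessLib

/-!
# The one-shift window system, LXXIV: THE MASKED TAIL-SENSITIVITY CHAIN OVER THE CENTRED GRID — part LXIX verbatim for
# the masked step of part LXXIII: a `SensD` record read as `(pB, ZB, pE, ZE)` (wake / top start sensitivities and their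
# K–Z increments), the per-step Boolean `GridD.sensStepOKM sd mW mT s`, the SAME link Boolean `sensLinkOK`, and the theorem
# that two runs of two realisations whose factors are twins at the row-wise distance `B·[mW] + E·[mT]`, from starts
# `|a − b|_i ≤ pB_{0,i} B + pE_{0,i} E`, satisfy `|S_u(τ) − S_v(τ)|_i ≤ (pB_s + ZB_s)_i B + (pE_s + ZE_s)_i E` at every time of
# every step (cell harvest/h2-tao-ladder, seat p2; rung1/RUNG1-P2G16-REPORT.md §83 (K2: Ẑ_b, Ẑ_e chained);
# support for K1(1) = `NoSurvivingDSSOne`, stmt-NavierStokesRegularity-20205)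

MODEL lattice ODEs only (Tao 2016 §4 normal form on Tao's shift set `S`); nothing here is a statement about
the Navier–Stokes equations; no item is closed; no instance is evaluated here. Generic in `ι`, `κ`; COMPUTATIONAL
(referee P162) once an instance's Booleans are evaluated by `native_decide`.
-/

noncomputable section

-- the sub-problem namespace repeats the summit name by design (D-0017)
set_option linter.dupNamespace false

namespace Summit.NavierStokesRegularity.NavierStokesRegularity.Theorems

namespace DSSOneShift

open Set Finset Metric Filter Topology TopologicalSpace
open Literature.Analysis.ODE
open Summit.NavierStokesRegularity.NavierStokesRegularity.Theorems.TaylorModelCert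
open Summit.NavierStokesRegularity.NavierStokesRegularity.Theorems.TaylorModelReadout
open Summit.NavierStokesRegularity.NavierStokesRegularity.Theorems.CertificateGlueOn

/-! ### The masked per-step Boolean -/

namespace GridD

variable (g : GridD) (sd : SensD)

/-- The masked sensitivity test of step `s` (part LXXIII `PairStepD.sensOKM`), the record `sd` read as `(pB, ZB, pE, ZE)`.
[cite: KapelaZgliczynski2009, §4 Lemma 8 / Thm. 9] -/
def sensStepOKM (mW mT : ℕ → Bool) (s : ℕ) : Bool :=
  (g.step s).sensOKM mW mT (sd.pYf s) (sd.ZYf s) (sd.pTf s) (sd.ZTf s)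

end GridD

namespace GridCD

variable (g : GridCD)

section Sound

variable {ι : Type*} [Fintype ι] [DecidableEq ι] {κ : Type*} [Fintype κ]

/-- **THE MASKED SENSITIVITY INVARIANT AT THE GRID TIMES** (part LXIX for the masked step of part LXXIII). Two runs `S_u` (realisation `Tf₁`, start `a ∈ W_0`) and `S_v`
(realisation `Tf₂`, start `b ∈ W_0`) on `[0, T]`, `t_S ≤ T`, each with a reference run from `P_0` of its own realisation,
the realisations twins at the row-wise distance `B·[mW] + E·[mT]` at all times, all grid tests and all masked sensitivity /
link tests passed, and `|a − b|_i ≤ pB_{0,i} B + pE_{0,i} E`: then `|S_u(t_s) − S_v(t_s)|_i ≤ pB_{s,i} B + pE_{s,i} E` for every `s ≤ S`.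
[cite: KapelaZgliczynski2009, §4 Lemma 8 / Thm. 9; Moore1979, §8.1 eq. (8.13); cell vocabulary, harvest/h2-tao-ladder rung1/RUNG1-P2G16-REPORT.md §83] -/
theorem abs_start_sub_le_of_gridCE_sensM (e : ι ≃ Fin g.n) (hn : ∀ s, (g.step s).n = g.n)
    {Tc : ℕ → κ → BTerm ι} {Tf₁ Tf₂ : ℝ → κ → BTerm ι} {rows : ι → List κ}
    (hRDc : ∀ s ≤ g.S, IsRTEncl (g.es e hn s) (Tc s) (Tc s) rows (g.step s).RD)
    (hRD₁ : ∀ s ≤ g.S, ∀ r ∈ Ico 0 (g.h s).toReal, IsRTEncl (g.es e hn s) (Tc s) (Tf₁ (g.t s + r)) rows (g.step s).RD)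
    (hRD₂ : ∀ s ≤ g.S, ∀ r ∈ Ico 0 (g.h s).toReal, IsRTEncl (g.es e hn s) (Tc s) (Tf₂ (g.t s + r)) rows (g.step s).RD)
    (hstep : ∀ s ≤ g.S, g.stepOK s = true) (hinit : g.initOK = true) (hprod : ∀ s < g.S, g.prodOKE s = true)
    (hpwf : ∀ s ≤ g.S, g.pwfOK s = true) (hpsub : ∀ s ≤ g.S, g.psubOK s = true)
    (hplink : ∀ s < g.S, g.plinkOK s = true) (hwlink : ∀ s < g.S, g.wlinkOK s = true)
    (sd : SensD) {mW mT : ℕ → Bool} (hsens : ∀ s ≤ g.S, g.sensStepOKM sd mW mT s = true)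
    (hlink : ∀ s < g.S, g.sensLinkOK sd s = true)
    {B E : ℝ} (hB : 0 ≤ B) (hE : 0 ≤ E)
    (htwin : ∀ t : ℝ, ∀ i, ∀ k ∈ rows i,
      Factor.Twin (B * maskR mW (e i) + E * maskR mT (e i)) (Tf₁ t k).fa (Tf₂ t k).fa ∧
      Factor.Twin (B * maskR mW (e i) + E * maskR mT (e i)) (Tf₁ t k).fb (Tf₂ t k).fb)
    {T : ℝ} (hT : g.t g.S ≤ T)
    {c₁ : ι → ℝ} (hc₁ : c₁ ∈ boxSet (boxOf e (g.P 0))) {Sc₁ : ℝ → ι → ℝ} (hSc₁0 : Sc₁ 0 = c₁)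
    (hSc₁ : ∀ t ∈ Icc 0 T, HasDerivWithinAt Sc₁ (termField (Tf₁ t) (Sc₁ t)) (Icc 0 T) t)
    {c₂ : ι → ℝ} (hc₂ : c₂ ∈ boxSet (boxOf e (g.P 0))) {Sc₂ : ℝ → ι → ℝ} (hSc₂0 : Sc₂ 0 = c₂)
    (hSc₂ : ∀ t ∈ Icc 0 T, HasDerivWithinAt Sc₂ (termField (Tf₂ t) (Sc₂ t)) (Icc 0 T) t)
    {a : ι → ℝ} (ha : a ∈ boxSet (boxOf e (g.step 0).W)) {Su : ℝ → ι → ℝ} (hSu0 : Su 0 = a)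
    (hSu : ∀ t ∈ Icc 0 T, HasDerivWithinAt Su (termField (Tf₁ t) (Su t)) (Icc 0 T) t)
    {b : ι → ℝ} (hb : b ∈ boxSet (boxOf e (g.step 0).W)) {Sv : ℝ → ι → ℝ} (hSv0 : Sv 0 = b)
    (hSv : ∀ t ∈ Icc 0 T, HasDerivWithinAt Sv (termField (Tf₂ t) (Sv t)) (Icc 0 T) t)
    (h0 : ∀ i, |a i - b i| ≤ (sd.pYf 0 (e i)).toReal * B + (sd.pTf 0 (e i)).toReal * E) :
    ∀ s ≤ g.S, ∀ i, |Su (g.t s) i - Sv (g.t s) i| ≤ (sd.pYf s (e i)).toReal * B + (sd.pTf s (e i)).toReal * E := by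
  classical
  have hh : ∀ s ≤ g.S, 0 ≤ (g.h s).toReal := fun s hs => (g.h_nonneg_and_wfW (hstep s hs)).1
  -- hull membership of both runs (part LXIV)
  have hHu := g.traj_mem_Hs_of_gridCE e hn hRDc hRD₁ hstep hinit hprod hpwf hpsub hplink hwlink hT hc₁ hSc₁0 hSc₁ ha hSu0 hSu
  have hHv := g.traj_mem_Hs_of_gridCE e hn hRDc hRD₂ hstep hinit hprod hpwf hpsub hplink hwlink hT hc₂ hSc₂0 hSc₂ hb hSv0 hSv
  intro s
  induction s with
  | zero =>
    intro _ i
    simp only [GridD.t_zero, hSu0, hSv0]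
    exact h0 i
  | succ s ih =>
    intro hs i
    have hs' : s < g.S := Nat.lt_of_succ_le hs
    have hprev := ih hs'.le
    -- facts of step `s`
    have hchk : (g.step s).check = true := by
      have := hstep s hs'.le
      simp only [GridD.stepOK, Bool.and_eq_true, decide_eq_true_eq] at this
      exact this.1
    have hc' : (g.step s).toRoughStepD.check = true ∧ (g.step s).checkPair = true := by
      simpa [PairStepD.check, Bool.and_eq_true] using hchk
    have hrc' : (g.step s).toRoughStepD.centre.check = true ∧ (g.step s).toRoughStepD.checkKZ = true := by
      simpa [RoughStepD.check, Bool.and_eq_true] using hc'.1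
    obtain ⟨heta, hKZ⟩ := (g.step s).toRoughStepD.of_checkKZ hrc'.2
    have hcw := (g.step s).toRoughStepD.centre.of_checkWith (by rw [← CentreStepD.check_eq]; exact hrc'.1)
    have hwfS : ∀ c < (g.step s).n, wfsD (IntervalD.aget (g.step s).S c) = true := fun c hc => (hcw.2.2.1 c hc).2.1
    have hZ : ∀ c < (g.step s).n, 0 ≤ (RoughStepD.dget (g.step s).Zh c).toReal := fun c hc => (hKZ c hc).1
    have hmemH : ∀ x ∈ boxSet (boxOf (g.es e hn s) (g.step s).Hs), ∀ i,
        IntervalD.mem (x i) (IntervalD.aget (g.step s).Hs (g.es e hn s i)) := fun x hx i =>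
      (g.step s).toRoughStepD.mem_of_mem_Hs (g.es e hn s) hwfS hZ heta hx i
    -- times
    have ht0 : 0 ≤ g.t s := g.t_nonneg fun k hk => hh k (by omega)
    have htsT : g.t s + (g.h s).toReal ≤ T := by
      rw [← GridD.t_succ]; exact (g.t_mono hs fun k hk => hh k (by omega)).trans hT
    have hh' : (g.h s).toReal ∈ Icc 0 (g.step s).hD.toReal := ⟨hh s hs'.le, le_rfl⟩
    -- re-clocked runs
    have hrunU : ∀ r ∈ Icc 0 (g.h s).toReal, HasDerivWithinAt (fun r => Su (g.t s + r))
        (termField (Tf₁ (g.t s + r)) (Su (g.t s + r))) (Icc 0 (g.h s).toReal) r := fun r hr =>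
      hasDerivWithinAt_shift (S := Su) (S' := fun t => termField (Tf₁ t) (Su t)) hSu ht0 htsT hr
    have hrunV : ∀ r ∈ Icc 0 (g.h s).toReal, HasDerivWithinAt (fun r => Sv (g.t s + r))
        (termField (Tf₂ (g.t s + r)) (Sv (g.t s + r))) (Icc 0 (g.h s).toReal) r := fun r hr =>
      hasDerivWithinAt_shift (S := Sv) (S' := fun t => termField (Tf₂ t) (Sv t)) hSv ht0 htsT hr
    have hmem : ∀ r ∈ Ico 0 (g.h s).toReal, Su (g.t s + r) ∈ boxSet (boxOf (g.es e hn s) (g.step s).Hs) ∧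
        Sv (g.t s + r) ∈ boxSet (boxOf (g.es e hn s) (g.step s).Hs) := by
      intro r hr
      rw [GridD.boxOf_es]
      exact ⟨hHu s hs'.le (g.t s + r) ⟨by linarith [hr.1], by linarith [hr.2]⟩ (by linarith [hr.2]),
        hHv s hs'.le (g.t s + r) ⟨by linarith [hr.1], by linarith [hr.2]⟩ (by linarith [hr.2])⟩
    have hstart : ∀ i, |Su (g.t s + 0) i - Sv (g.t s + 0) i| ≤
        (sd.pYf s (g.es e hn s i)).toReal * B + (sd.pTf s (g.es e hn s i)).toReal * E := by
      intro i; simp only [add_zero, GridD.es_val]; exact hprev i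
    have htwin' : ∀ r ∈ Ico 0 (g.h s).toReal, ∀ i, ∀ k ∈ rows i,
        Factor.Twin (B * maskR mW (g.es e hn s i) + E * maskR mT (g.es e hn s i)) (Tf₁ (g.t s + r) k).fa (Tf₂ (g.t s + r) k).fa ∧
        Factor.Twin (B * maskR mW (g.es e hn s i) + E * maskR mT (g.es e hn s i)) (Tf₁ (g.t s + r) k).fb (Tf₂ (g.t s + r) k).fb := by
      intro r _ i k hk; simp only [GridD.es_val]; exact htwin (g.t s + r) i k hk
    have hres := (g.step s).abs_sensM_le (g.es e hn s) (hRDc s hs'.le) hh' (hRD₁ s hs'.le) (hRD₂ s hs'.le) hB hE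
      htwin' hchk (by simpa [GridD.sensStepOKM] using hsens s hs'.le) hmemH
      hrunU hrunV hmem hstart (g.h s).toReal ⟨hh s hs'.le, le_rfl⟩ i
    simp only [GridD.es_val] at hres
    have hlk := g.of_sensLinkOK sd (hlink s hs') (e i) (e i).isLt
    rw [GridD.t_succ]
    have hfin : Fin.mk (e i : ℕ) (by rw [hn]; exact (e i).isLt) = g.es e hn s i := Fin.ext (by simp)
    calc |Su (g.t s + (g.h s).toReal) i - Sv (g.t s + (g.h s).toReal) i|
        ≤ ((sd.pYf s (e i)).toReal + (sd.ZYf s (e i)).toReal) * B +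
          ((sd.pTf s (e i)).toReal + (sd.ZTf s (e i)).toReal) * E := hres
      _ ≤ (sd.pYf (s + 1) (e i)).toReal * B + (sd.pTf (s + 1) (e i)).toReal * E :=
          add_le_add (mul_le_mul_of_nonneg_right hlk.1 hB) (mul_le_mul_of_nonneg_right hlk.2 hE)

/-- **THE MASKED TWO-RUN SENSITIVITY BOUND AT EVERY TIME OF THE GRID** (part LXIX for the masked step of part LXXIII). Under the hypotheses of
`abs_start_sub_le_of_gridCE_sensM` and `T ≤ t_S + h_S`: for every step `s ≤ S` and every `τ ∈ [t_s, T]` with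
`τ ≤ t_s + h_s`, `|S_u(τ) − S_v(τ)|_i ≤ (pB_s + ZB_s)_i B + (pE_s + ZE_s)_i E`.
[cite: KapelaZgliczynski2009, §4 Lemma 8 / Thm. 9; WalawskaWilczak2016, §2.2 Lemma 2; Moore1979, §8.1 eq. (8.13); cell vocabulary, harvest/h2-tao-ladder rung1/RUNG1-P2G16-REPORT.md §83 (K2)] -/
theorem abs_sub_le_of_gridCE_sensM (e : ι ≃ Fin g.n) (hn : ∀ s, (g.step s).n = g.n)
    {Tc : ℕ → κ → BTerm ι} {Tf₁ Tf₂ : ℝ → κ → BTerm ι} {rows : ι → List κ}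
    (hRDc : ∀ s ≤ g.S, IsRTEncl (g.es e hn s) (Tc s) (Tc s) rows (g.step s).RD)
    (hRD₁ : ∀ s ≤ g.S, ∀ r ∈ Ico 0 (g.h s).toReal, IsRTEncl (g.es e hn s) (Tc s) (Tf₁ (g.t s + r)) rows (g.step s).RD)
    (hRD₂ : ∀ s ≤ g.S, ∀ r ∈ Ico 0 (g.h s).toReal, IsRTEncl (g.es e hn s) (Tc s) (Tf₂ (g.t s + r)) rows (g.step s).RD)
    (hstep : ∀ s ≤ g.S, g.stepOK s = true) (hinit : g.initOK = true) (hprod : ∀ s < g.S, g.prodOKE s = true)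
    (hpwf : ∀ s ≤ g.S, g.pwfOK s = true) (hpsub : ∀ s ≤ g.S, g.psubOK s = true)
    (hplink : ∀ s < g.S, g.plinkOK s = true) (hwlink : ∀ s < g.S, g.wlinkOK s = true)
    (sd : SensD) {mW mT : ℕ → Bool} (hsens : ∀ s ≤ g.S, g.sensStepOKM sd mW mT s = true)
    (hlink : ∀ s < g.S, g.sensLinkOK sd s = true)
    {B E : ℝ} (hB : 0 ≤ B) (hE : 0 ≤ E)
    (htwin : ∀ t : ℝ, ∀ i, ∀ k ∈ rows i,
      Factor.Twin (B * maskR mW (e i) + E * maskR mT (e i)) (Tf₁ t k).fa (Tf₂ t k).fa ∧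
      Factor.Twin (B * maskR mW (e i) + E * maskR mT (e i)) (Tf₁ t k).fb (Tf₂ t k).fb)
    {T : ℝ} (hT : g.t g.S ≤ T)
    {c₁ : ι → ℝ} (hc₁ : c₁ ∈ boxSet (boxOf e (g.P 0))) {Sc₁ : ℝ → ι → ℝ} (hSc₁0 : Sc₁ 0 = c₁)
    (hSc₁ : ∀ t ∈ Icc 0 T, HasDerivWithinAt Sc₁ (termField (Tf₁ t) (Sc₁ t)) (Icc 0 T) t)
    {c₂ : ι → ℝ} (hc₂ : c₂ ∈ boxSet (boxOf e (g.P 0))) {Sc₂ : ℝ → ι → ℝ} (hSc₂0 : Sc₂ 0 = c₂)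
    (hSc₂ : ∀ t ∈ Icc 0 T, HasDerivWithinAt Sc₂ (termField (Tf₂ t) (Sc₂ t)) (Icc 0 T) t)
    {a : ι → ℝ} (ha : a ∈ boxSet (boxOf e (g.step 0).W)) {Su : ℝ → ι → ℝ} (hSu0 : Su 0 = a)
    (hSu : ∀ t ∈ Icc 0 T, HasDerivWithinAt Su (termField (Tf₁ t) (Su t)) (Icc 0 T) t)
    {b : ι → ℝ} (hb : b ∈ boxSet (boxOf e (g.step 0).W)) {Sv : ℝ → ι → ℝ} (hSv0 : Sv 0 = b)
    (hSv : ∀ t ∈ Icc 0 T, HasDerivWithinAt Sv (termField (Tf₂ t) (Sv t)) (Icc 0 T) t)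
    (h0 : ∀ i, |a i - b i| ≤ (sd.pYf 0 (e i)).toReal * B + (sd.pTf 0 (e i)).toReal * E) :
    ∀ s ≤ g.S, ∀ τ ∈ Icc (g.t s) T, τ ≤ g.t s + (g.h s).toReal → ∀ i,
      |Su τ i - Sv τ i| ≤ ((sd.pYf s (e i)).toReal + (sd.ZYf s (e i)).toReal) * B +
        ((sd.pTf s (e i)).toReal + (sd.ZTf s (e i)).toReal) * E := by
  classical
  intro s hs τ hτ hτh i
  have hh : ∀ s ≤ g.S, 0 ≤ (g.h s).toReal := fun s hs => (g.h_nonneg_and_wfW (hstep s hs)).1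
  have hHu := g.traj_mem_Hs_of_gridCE e hn hRDc hRD₁ hstep hinit hprod hpwf hpsub hplink hwlink hT hc₁ hSc₁0 hSc₁ ha hSu0 hSu
  have hHv := g.traj_mem_Hs_of_gridCE e hn hRDc hRD₂ hstep hinit hprod hpwf hpsub hplink hwlink hT hc₂ hSc₂0 hSc₂ hb hSv0 hSv
  have hinv := g.abs_start_sub_le_of_gridCE_sensM e hn hRDc hRD₁ hRD₂ hstep hinit hprod hpwf hpsub hplink hwlink sd hsens hlink
    hB hE htwin hT hc₁ hSc₁0 hSc₁ hc₂ hSc₂0 hSc₂ ha hSu0 hSu hb hSv0 hSv h0 s hs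
  -- facts of step `s`
  have hchk : (g.step s).check = true := by
    have := hstep s hs
    simp only [GridD.stepOK, Bool.and_eq_true, decide_eq_true_eq] at this
    exact this.1
  have hc' : (g.step s).toRoughStepD.check = true ∧ (g.step s).checkPair = true := by
    simpa [PairStepD.check, Bool.and_eq_true] using hchk
  have hrc' : (g.step s).toRoughStepD.centre.check = true ∧ (g.step s).toRoughStepD.checkKZ = true := by
    simpa [RoughStepD.check, Bool.and_eq_true] using hc'.1
  obtain ⟨heta, hKZ⟩ := (g.step s).toRoughStepD.of_checkKZ hrc'.2
  have hcw := (g.step s).toRoughStepD.centre.of_checkWith (by rw [← CentreStepD.check_eq]; exact hrc'.1)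
  have hwfS : ∀ c < (g.step s).n, wfsD (IntervalD.aget (g.step s).S c) = true := fun c hc => (hcw.2.2.1 c hc).2.1
  have hZ : ∀ c < (g.step s).n, 0 ≤ (RoughStepD.dget (g.step s).Zh c).toReal := fun c hc => (hKZ c hc).1
  have hmemH : ∀ x ∈ boxSet (boxOf (g.es e hn s) (g.step s).Hs), ∀ i,
      IntervalD.mem (x i) (IntervalD.aget (g.step s).Hs (g.es e hn s i)) := fun x hx i =>
    (g.step s).toRoughStepD.mem_of_mem_Hs (g.es e hn s) hwfS hZ heta hx i
  -- the re-clocked runs on `[0, τ − t_s]`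
  have ht0 : 0 ≤ g.t s := g.t_nonneg fun k hk => hh k (by omega)
  set h' : ℝ := τ - g.t s with hh'def
  have hh' : h' ∈ Icc 0 (g.step s).hD.toReal :=
    ⟨by simp only [hh'def]; linarith [hτ.1], by simp only [hh'def]; show τ - g.t s ≤ (g.h s).toReal; linarith⟩
  have hτT : g.t s + h' ≤ T := by simp only [hh'def]; linarith [hτ.2]
  have hrunU : ∀ r ∈ Icc 0 h', HasDerivWithinAt (fun r => Su (g.t s + r))
      (termField (Tf₁ (g.t s + r)) (Su (g.t s + r))) (Icc 0 h') r := fun r hr =>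
    hasDerivWithinAt_shift (S := Su) (S' := fun t => termField (Tf₁ t) (Su t)) hSu ht0 hτT hr
  have hrunV : ∀ r ∈ Icc 0 h', HasDerivWithinAt (fun r => Sv (g.t s + r))
      (termField (Tf₂ (g.t s + r)) (Sv (g.t s + r))) (Icc 0 h') r := fun r hr =>
    hasDerivWithinAt_shift (S := Sv) (S' := fun t => termField (Tf₂ t) (Sv t)) hSv ht0 hτT hr
  have hmem : ∀ r ∈ Ico 0 h', Su (g.t s + r) ∈ boxSet (boxOf (g.es e hn s) (g.step s).Hs) ∧
      Sv (g.t s + r) ∈ boxSet (boxOf (g.es e hn s) (g.step s).Hs) := by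
    intro r hr
    rw [GridD.boxOf_es]
    have h1 : g.t s + r ∈ Icc (g.t s) T := ⟨by linarith [hr.1], by simp only [hh'def] at hr; linarith [hr.2, hτ.2]⟩
    have h2 : g.t s + r ≤ g.t s + (g.h s).toReal := by simp only [hh'def] at hr; linarith [hr.2]
    exact ⟨hHu s hs _ h1 h2, hHv s hs _ h1 h2⟩
  have hRD₁' : ∀ r ∈ Ico 0 h', IsRTEncl (g.es e hn s) (Tc s) (Tf₁ (g.t s + r)) rows (g.step s).RD := fun r hr =>
    hRD₁ s hs r ⟨hr.1, lt_of_lt_of_le hr.2 hh'.2⟩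
  have hRD₂' : ∀ r ∈ Ico 0 h', IsRTEncl (g.es e hn s) (Tc s) (Tf₂ (g.t s + r)) rows (g.step s).RD := fun r hr =>
    hRD₂ s hs r ⟨hr.1, lt_of_lt_of_le hr.2 hh'.2⟩
  have hstart : ∀ i, |Su (g.t s + 0) i - Sv (g.t s + 0) i| ≤
      (sd.pYf s (g.es e hn s i)).toReal * B + (sd.pTf s (g.es e hn s i)).toReal * E := by
    intro i; simp only [add_zero, GridD.es_val]; exact hinv i
  have htwin' : ∀ r ∈ Ico 0 h', ∀ i, ∀ k ∈ rows i,
      Factor.Twin (B * maskR mW (g.es e hn s i) + E * maskR mT (g.es e hn s i)) (Tf₁ (g.t s + r) k).fa (Tf₂ (g.t s + r) k).fa ∧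
      Factor.Twin (B * maskR mW (g.es e hn s i) + E * maskR mT (g.es e hn s i)) (Tf₁ (g.t s + r) k).fb (Tf₂ (g.t s + r) k).fb := by
    intro r _ i k hk; simp only [GridD.es_val]; exact htwin (g.t s + r) i k hk
  have hres := (g.step s).abs_sensM_le (g.es e hn s) (hRDc s hs) hh' hRD₁' hRD₂' hB hE
    htwin' hchk (by simpa [GridD.sensStepOKM] using hsens s hs) hmemH
    hrunU hrunV hmem hstart h' ⟨hh'.1, le_rfl⟩ i
  simp only [GridD.es_val] at hres
  have e1 : g.t s + h' = τ := by simp only [hh'def]; ring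
  rw [e1] at hres
  exact hres

end Sound

end GridCD

end DSSOneShift

end Summit.NavierStokesRegularity.NavierStokesRegularity.Theorems
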